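import Summits.BirchSwinnertonDyer.BirchSwinnertonDyer.Theorems.KimAtThreeFineKatoLemmaL
import Summits.BirchSwinnertonDyer.BirchSwinnertonDyer.Theorems.KimAtThreePortSharedSATCore
import Summits.BirchSwinnertonDyer.BirchSwinnertonDyer.Theorems.KimAtThreeFineKatoSemiLocalLatticeInt
import HarnessLib

/-!
# The TWO-EXPONENT (P-EXP) rider at `ℚ₃` on EVERY additive `t = 0` row (Kodaira IV/IV* `c₃ = 3` INCLUDED),
# `Λfin` CONSTRUCTED, clauses (i) PROVED and (ii₂) GLUED to the scalar core of SAT₀ — the rider block of support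
# item 20398 `FineKatoTwoExpDefectThree` (route W2 `KimAtThreeKolyvagin`; additive-defect `t = 0` rows of the
# cruxes 19599 / 19679 / 19077) from ONE displayed semi-local package with NO hypothesis on `c₃` or `c_P`
# (cell `bsd-addord`, seat w2-acc3 gen 9; helper, `--supports`)

HONEST FRAMING. TOOL theorems only (no definition, no named fact, no instance, no `sorry`); closes nothing;
nothing is booked; BSD is not proved by any of this.  The scalar dual exponential `φ = exp*_ω` at `ℚ₃` and
Kato's value datum `Λ` are ABSTRACT data; the `ℚ₃`-level print facts `hker` ([BK90] 3.8/3.11) and `hdual`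
(Tate duality in lattice form) and the semi-local package are DISPLAYED hypotheses — exactly those of kim3
gen 13's `KimAtThreeFineKatoRiderAssembly.exists_katoExpStarFiniteLevelAt_of_semiLocal` (p490927) and of
`KimAtThreeFineKatoSemiLocalAssembly.exists_katoExpStarFiniteLevelAt_of_semiLocalInt` (kim3 gen 14).

WHAT IS NEW.  Those two theorems carry the Kato-stratum binder `3 ∤ c₃` and use it in exactly ONE place:
Lemma L at `ℚ₃` (`KimAtThreeFineKatoLemmaL.lemmaL_range_three`: `exp*_ω(H¹(ℚ₃, T₃E)) = ℤ₃`, from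
`log_ω E(ℚ₃) = ℤ₃`).  On an additive `t = 0` row with `3 ∣ c₃` (Kodaira IV / IV*, `c₃ = 3`; the
additive-DEFECT rows of item 20398) the points side reads instead `log_ω E(ℚ₃) = 3^{−v₃(c₃)} ℤ₃`
(n1011's `range_padicLog_eq_span_zpow_of_hasAdditiveReduction`, «F-b built in», through
`dual_range_padicLog_baseChange_of_addv`), hence `exp*_ω(H¹(ℚ₃, T₃E)) = 3^{e} ℤ₃` with
`e := v₃(c₃) ∈ {0, 1}`, and the finite-level functional must be `Λfin_j := (3^{−e}·exp*_ω ∘ lift) mod 3^{j+1}`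
— n1011's TWO-EXPONENT reading of the rider (`KatoExpStarFiniteLevelAt` clause (ii) with the conclusion
multiplied by `3^e`: the (ii₂) of seats acc6 / acc3 / w2-c3, item 20398's compatibility clause).  Clause
(ii₂) is then the SAME scalar core of SAT₀ (w2-acc4's `KimAtThreePortSharedSATCore`), because SAT₀ never
used `c₃`: its E-side input is a unit-trace element of the per-factor log-lattice of `E₀(L_w)` (kport's
`consumer_of_addv`), and its conclusion is about the `ℚ₃`-RATIONAL scalar `exp*_ω(h) − s` only (n1011
ROUTE-1 D-53-1/D-53-6: the per-factor LATTICE bound is false on hidden-torsion rows — this seat's gen-8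
obstruction `KimAtThreeAdditiveHiddenTorsionLattice` — while the scalar conclusion survives at full
strength).  So:

* §1 `dual_range_padicLog_three_of_addv` — the points side at `ℚ₃` for ANY `c₃`:
  `(∀ P, ‖a · log_ω P‖ ≤ 1) ↔ a ∈ 3^{v₃(c₃)} ℤ₃` (`Addv W 3`, `#E(ℚ₃)[3] = 1`);
  `padicValNat_card_torsion_baseChange_three_eq_zero` (`t = 0` in n1011's currency).
* §2 `exists_fineKatoTwoExp_of_semiLocalInt` — from `φ` + `hker` + `hdual` + the semi-local package in the
  `L_int′` currency (VERBATIM the `hsemi` of kim3 gen 14's `…_of_semiLocalInt`, compat exponent `3⁰`):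
  **`∃ Λfin e, e = v₃(c₃) ∧ (∀ j, (i-a) ∧ (i-b)) ∧ (∀ j, (ii₂))` ∧ interface**, where (ii₂) is item 20398's
  compatibility clause token for token (`… → ((3 ^ e : ℕ) : ZMod (3 ^ (j + 1))) * Λfin j (loc κ₀) = s mod 3^{j+1}`);
  `exists_fineKatoTwoExp_of_semiLocal` — the same with the package in the `cycIntLattice` currency (kim3 gen 13's
  `hsemi`).
Proof: `φ′ := 3^{−e}·φ` is integral with range `⊇ ℤ₃` and the same kernel as `φ`, so kim3's ABSTRACT §2 of
`KimAtThreeFineKatoLemmaL` (any `p`, `v`, `k`) builds `Λfin_j` with the interface for `φ′` and proves (i);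
for (ii₂): lift `loc κ₀` to `h`, the package's COMPAT gives `φ(h) ⊗ 1 − Λ_{0,r} y ∈ 3^{j+1}·M`, the scalar
core gives `φ(h) ≡ s (mod 3^{j+1})` (`φ(h) ∈ ℤ₃` since `e ≥ 0`), and `3^e · Λfin_j(π h) = 3^e · (3^{−e}φ(h)) = φ(h)`
in `ℤ/3^{j+1}`.  On the stratum (`3 ∤ c₃`, `e = 0`) this is kim3's rider again.

References: S. Bloch, K. Kato (1990) §3 Prop. 3.8, Ex. 3.11 [BlochKato1990]; C.-H. Kim, AJM 148 (2026) =
arXiv:2203.12159 §3.2.3 (display before Thm. 3.7), Rem. 3.8, Lemma 3.10, §3.3 (Lemma 3.11, Prop. 3.12),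
§3.4.1, proof of Thm. 3.13 [Kim2022StructureSelmer]; C.-H. Kim, K. Nakamura, JNT 210 (2020) Thm. 2.1 /
Cor. 2.4 [KimNakamura2020]; n1011 ROUTE-1 §17 F-b, §53.3–§53.4 (D-53-1 … D-53-7); kim3 memos
KIM3-W2-C1-g11 §2, KIM3-W2-C1b-KERNEL-g13 §3.
-/

noncomputable section

-- the cell's Theorems namespace `Summit.BirchSwinnertonDyer.BirchSwinnertonDyer.…` repeats the summit name by design (D-0017)
set_option linter.dupNamespace false

open scoped Classical NumberField TensorProduct ContRepresentation
open Field NumberField IsDedekindDomain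
open WeierstrassCurve Literature.NumberTheory.EllipticCurves Literature.NumberTheory.GaloisRepresentations
  Literature.NumberTheory.GaloisRepresentations.DiscreteGaloisModule Literature.NumberTheory.GaloisCohomology
open Literature.NumberTheory.EllipticCurves.ModularForms Literature.NumberTheory.EllipticCurves.Rank1Residual
open Literature.NumberTheory.EllipticCurves.Kato2004 Literature.NumberTheory.EllipticCurves.Kato2004.EulerSystemValues
open Summit.BirchSwinnertonDyer.Rank1Residual.GaloisImage
open Summit.BirchSwinnertonDyer.Rank1Residual.Additive.LocalLog
open Summit.BirchSwinnertonDyer.BirchSwinnertonDyer.Theorems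
open Summit.BirchSwinnertonDyer.BirchSwinnertonDyer.Theorems.KimAtThreePortSharedSATCore
open Summit.BirchSwinnertonDyer.BirchSwinnertonDyer.Theorems.KimAtThreeFineKatoSemiLocalLatticeInt

namespace Summit.BirchSwinnertonDyer.BirchSwinnertonDyer.Theorems.KimAtThreeFineKatoTwoExpRiderAssembly

variable (W : WeierstrassCurve ℚ) [W.IsElliptic] [W.IsGloballyMinimal] [ContinuousSMul ℤ_[3] (W.tateModule 3)]

/-! ### §1. The points side at `ℚ₃` on EVERY additive `t = 0` row: the dual of `log_ω E(ℚ₃)` is `3^{v₃(c₃)} ℤ₃` -/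

omit [ContinuousSMul ℤ_[3] (W.tateModule 3)] in
/-- `t = 0` in n1011's currency: `#E(ℚ₃)[3] = 1` (the items' `Nat.card` binder) gives
`v₃ #E(ℚ₃)_tors = 0` (Cauchy). [folklore] -/
theorem padicValNat_card_torsion_baseChange_three_eq_zero
    (ht : Nat.card {Q : (W.baseChange ℚ_[3]).toAffine.Point // (3 : ℕ) • Q = 0} = 1) :
    padicValNat 3 (Nat.card (AddCommGroup.torsion (W.baseChange ℚ_[3]).toAffine.Point)) = 0 := by
  have ht' := KimAtThreeFineKatoSATPoints.forall_p_nsmul_eq_zero_of_natCard_eq_one (W.baseChange ℚ_[3]) ht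
  apply padicValNat.eq_zero_of_not_dvd
  intro hdvd
  haveI := finite_torsion_point (W.baseChange ℚ_[3])
  obtain ⟨T, hT⟩ := exists_prime_addOrderOf_dvd_card'
    (G := AddCommGroup.torsion (W.baseChange ℚ_[3]).toAffine.Point) 3 hdvd
  have hpT' : 3 • T = 0 := by
    have h := addOrderOf_nsmul_eq_zero T
    rwa [hT] at h
  have hpT : (3 : ℕ) • (T : (W.baseChange ℚ_[3]).toAffine.Point) = 0 := by
    have h := congrArg Subtype.val hpT'
    simpa only [AddSubgroupClass.coe_nsmul, ZeroMemClass.coe_zero] using h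
  have hT0 : T = 0 := Subtype.ext (ht' _ hpT)
  rw [hT0, addOrderOf_zero] at hT
  exact absurd hT (by norm_num)

omit [ContinuousSMul ℤ_[3] (W.tateModule 3)] in
/-- **The points side of Lemma L (ii) / (I2) on EVERY additive `t = 0` row** (`Addv W 3`, `#E(ℚ₃)[3] = 1`, ANY
`c₃`): for `a ∈ ℚ₃`, `a · log_ω P ∈ ℤ₃` for every `P ∈ E(ℚ₃)` iff `a ∈ 3^{v₃(c₃)} ℤ₃` — n1011's
`dual_range_padicLog_baseChange_of_addv` (`log_ω E(ℚ₃) = 3^{t − v₃ c₃} ℤ₃`, Kodaira IV/IV* `c₃ = 3`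
built in) at `t = 0`.  With the Galois side `exp*_ω(H¹(ℚ₃, T₃E)) = (log_ω E(ℚ₃))^∨` (`hdual`, [BK90] 3.8
+ Tate duality) this reads `exp*_ω(H¹(ℚ₃, T₃E)) = 3^{v₃(c₃)} ℤ₃`.
[cite: Kim2022StructureSelmer, §3.2.3 (display before Thm. 3.7), Rem. 3.8 and Lemma 3.10 (PDF pp. 16–17)] -/
theorem dual_range_padicLog_three_of_addv (hadd : Addv W 3)
    (ht : Nat.card {Q : (W.baseChange ℚ_[3]).toAffine.Point // (3 : ℕ) • Q = 0} = 1) (a : ℚ_[3]) :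
    (∀ P : (W.baseChange ℚ_[3]).toAffine.Point, ‖a * padicLog (W.baseChange ℚ_[3]) P‖ ≤ 1) ↔
      a ∈ (Submodule.span ℤ_[3] {((3 : ℕ) : ℚ_[3]) ^
        padicValNat 3 ((W.baseChange ℚ_[3]).localTamagawaNumber ℤ_[3])}).toAddSubgroup := by
  have key := dual_range_padicLog_baseChange_of_addv W 3 hadd a
  rw [padicValNat_card_torsion_baseChange_three_eq_zero W ht, Nat.cast_zero, sub_zero,
    zpow_natCast] at key
  rw [← key]
  constructor
  · rintro h y ⟨P, rfl⟩
    exact h P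
  · intro h P
    exact h _ ⟨P, rfl⟩

/-! ### §2. The two-exponent rider at every depth from `φ`, `hker`, `hdual` and the semi-local package -/

set_option maxHeartbeats 400000 in
/-- **The TWO-EXPONENT rider of item 20398 at EVERY depth, `Λfin` CONSTRUCTED, on EVERY additive `t = 0`
row** (`Addv W 3`, `#E(ℚ₃)[3] = 1`, `v₃ ∣ 3`; NO hypothesis on `c₃` or `c_P`), from: (a) an abstract scalar
dual exponential `φ = exp*_ω : H¹(ℚ_{v₃}, T₃W) →+ ℚ₃` with the two ℚ₃-level PRINT facts `hker` ([BK90]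
3.8/3.11: kernel = `H¹_f`) and `hdual` (Tate duality: range = `(log_ω E(ℚ₃))^∨`) displayed; (b) the
DISPLAYED SEMI-LOCAL PACKAGE in the `L_int′` currency — VERBATIM the `hsemi` of kim3 gen 14's
`KimAtThreeFineKatoSemiLocalAssembly.exists_katoExpStarFiniteLevelAt_of_semiLocalInt`: per depth `j` and
tame level `r`, a set `Λ₀ ⊆ L_int′(m) = ℤ₃⟨1 ⊗ 𝓞_{ℚ(ζ_m)}⟩` with a unit-trace element (SAT₀'s E-side:
`Λ₀ = log_ω E₀(L_w)`, kport), a `ℤ₃`-submodule `M ⊆ Λ₀^∨` (the semi-local `exp*`-lattice), and COMPAT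
`φ(h) ⊗ 1 − 3⁰·Λ_{0,r}(y) ∈ 3^{j+1}·M` under the derivative-class shape.  CONCLUSION: `∃ Λfin e`, with
`e = v₃(c₃)`, clause (i) of `KatoExpStarFiniteLevelAt` (onto `ℤ/3^{j+1}` on `𝓕_can(v₃)`, kernel there = the
Kummer part) and the TWO-EXPONENT compatibility (ii₂) — the compatibility clause of
`Theses.KimAtThreeKolyvagin.FineKatoTwoExpDefectThree` (item 20398) token for token — at EVERY depth, plus
the interface `φ(y) = 3^e·s ⇒ Λfin_j(π_{j+1,*} y) = s mod 3^{j+1}`.  Proof: `φ′ := 3^{−e}·φ` is integral,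
has range `⊇ ℤ₃` (§1 + `hdual`) and the kernel of `φ`; kim3's abstract `exists_functional_tateLocalMap_eq` /
`lambda_clauses_of_interface` (`KimAtThreeFineKatoLemmaL` §2) give `Λfin` and (i); (ii₂) = COMPAT + w2-acc4's
scalar core `toZModPow_eq_of_sub_eq_smul_of_sub_eq_smul` (`L := L_int′`) + `3^e·(3^{−e}φ(h)) = φ(h)` in
`ℤ/3^{j+1}`.  Nothing about `exp*` is constructed; closes nothing.
[cite: Kim2022StructureSelmer, §3.3 (Lemma 3.11, Prop. 3.12), §3.4.1 and the proof of Thm. 3.13 (arXiv v3 pp. 26–27)]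
[cite: BlochKato1990, §3 (Prop. 3.8, Ex. 3.11)] [cite: KimNakamura2020, Thm. 2.1 and Cor. 2.4] -/
theorem exists_fineKatoTwoExp_of_semiLocalInt (hadd : Addv W 3)
    (ht : Nat.card {Q : (W.baseChange ℚ_[3]).toAffine.Point // (3 : ℕ) • Q = 0} = 1)
    (v₃ : HeightOneSpectrum (𝓞 ℚ)) (hv₃ : ((3 : ℕ) : 𝓞 ℚ) ∈ v₃.asIdeal)
    (φ : (tateLocalRep W 3 (Sum.inr v₃)).cohomology 1 →+ ℚ_[3])
    (hker : ∀ y, φ y = 0 ↔ ∀ j : ℕ, tateLocalMap W 3 j (Sum.inr v₃) y ∈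
      W.kummerSelmerStructure (((3 : ℕ) : ℤ) ^ j * ((3 : ℕ) : ℤ)) (Sum.inr v₃))
    (hdual : ∀ a : ℚ_[3], (∃ y, φ y = a) ↔
      ∀ P : (W.baseChange ℚ_[3]).toAffine.Point, ‖a * padicLog (W.baseChange ℚ_[3]) P‖ ≤ 1)
    (Λ : ∀ (k' : ℕ) (r : Finset (HeightOneSpectrum (𝓞 ℚ))),
      H1 (tateRep W 3) (cycSubgroup 3 k' r) →ₗ[ℤ_[3]] ℚ_[3] ⊗[ℚ] CyclotomicField (cycLevel 3 k' r) ℚ)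
    (hsemi : ∀ (j : ℕ) (r : Finset (HeightOneSpectrum (𝓞 ℚ))),
      ∃ (Λ₀ : Set (ℚ_[3] ⊗[ℚ] CyclotomicField (cycLevel 3 0 r) ℚ))
        (M : Submodule ℤ_[3] (ℚ_[3] ⊗[ℚ] CyclotomicField (cycLevel 3 0 r) ℚ)),
        Λ₀ ⊆ Submodule.span ℤ_[3] (Set.range fun b : 𝓞 (CyclotomicField (cycLevel 3 0 r) ℚ) ↦
          (1 : ℚ_[3]) ⊗ₜ[ℚ] (b : CyclotomicField (cycLevel 3 0 r) ℚ)) ∧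
        (∃ ℓ ∈ Λ₀, ‖Algebra.trace ℚ_[3] (ℚ_[3] ⊗[ℚ] CyclotomicField (cycLevel 3 0 r) ℚ) ℓ‖ = 1) ∧
        (∀ μ ∈ M, ∀ ℓ ∈ Λ₀,
          ‖Algebra.trace ℚ_[3] (ℚ_[3] ⊗[ℚ] CyclotomicField (cycLevel 3 0 r) ℚ) (μ * ℓ)‖ ≤ 1) ∧
        ∀ (Ψ : H1 (tateRep W 3) (cycSubgroup 3 0 r) →+
            continuousCohomology 1 (subgroupRep
              (W.torsionGaloisModule (((3 : ℕ) : ℤ) ^ j * ((3 : ℕ) : ℤ))).toTopRep (cycSubgroup 3 0 r))),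
          (∀ (φ' : contOneCocycles (subgroupRep (tateRep W 3).toTopRep (cycSubgroup 3 0 r)))
              (ψ : contOneCocycles (subgroupRep
                (W.torsionGaloisModule (((3 : ℕ) : ℤ) ^ j * ((3 : ℕ) : ℤ))).toTopRep (cycSubgroup 3 0 r))),
              (∀ g, ((ψ.1 g : geomTorsion W (((3 : ℕ) : ℤ) ^ j * ((3 : ℕ) : ℤ))) : geomPoints W) =
                TateModule.proj 3 (j + 1) (φ'.1 g)) →
              Ψ (oneCocycleClass _ φ') = oneCocycleClass _ ψ) →
          ∀ (y : H1 (tateRep W 3) (cycSubgroup 3 0 r))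
            (κ₀ : galoisCohomology (W.torsionGaloisModule (((3 : ℕ) : ℤ) ^ j * ((3 : ℕ) : ℤ))) 1)
            (h : (tateLocalRep W 3 (Sum.inr v₃)).cohomology 1),
            resSubgroup (W.torsionGaloisModule (((3 : ℕ) : ℤ) ^ j * ((3 : ℕ) : ℤ))).toTopRep
                (cycSubgroup 3 0 r) 1 κ₀ = Ψ y →
            galoisCohomology.localization (W.torsionGaloisModule (((3 : ℕ) : ℤ) ^ j * ((3 : ℕ) : ℤ)))
                (Sum.inr v₃) 1 κ₀ = tateLocalMap W 3 j (Sum.inr v₃) h →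
            ∃ μ ∈ M, (φ h ⊗ₜ[ℚ] (1 : CyclotomicField (cycLevel 3 0 r) ℚ)) -
                (((3 : ℕ) : ℤ_[3]) ^ (0 : ℕ)) • Λ 0 r y = (((3 : ℕ) : ℤ_[3]) ^ (j + 1)) • (μ : _)) :
    ∃ (Λfin : ∀ j : ℕ, galoisCohomology
        ((W.torsionGaloisModule (((3 : ℕ) : ℤ) ^ j * ((3 : ℕ) : ℤ))).toLocal (Sum.inr v₃)) 1 →+
          ZMod (3 ^ (j + 1))) (e : ℕ),
      e = padicValNat 3 ((W.baseChange ℚ_[3]).localTamagawaNumber ℤ_[3]) ∧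
      (∀ j : ℕ, (∀ c : ZMod (3 ^ (j + 1)), ∃ x ∈ propagatedSelmerStructure W 3 j (Sum.inr v₃), Λfin j x = c) ∧
        (∀ x ∈ propagatedSelmerStructure W 3 j (Sum.inr v₃),
          Λfin j x = 0 ↔ x ∈ W.kummerSelmerStructure (((3 : ℕ) : ℤ) ^ j * ((3 : ℕ) : ℤ)) (Sum.inr v₃))) ∧
      (∀ j : ℕ, ∀ (r : Finset (HeightOneSpectrum (𝓞 ℚ)))
        (Ψ : H1 (tateRep W 3) (cycSubgroup 3 0 r) →+
          continuousCohomology 1 (subgroupRep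
            (W.torsionGaloisModule (((3 : ℕ) : ℤ) ^ j * ((3 : ℕ) : ℤ))).toTopRep (cycSubgroup 3 0 r))),
        (∀ (φ' : contOneCocycles (subgroupRep (tateRep W 3).toTopRep (cycSubgroup 3 0 r)))
            (ψ : contOneCocycles (subgroupRep
              (W.torsionGaloisModule (((3 : ℕ) : ℤ) ^ j * ((3 : ℕ) : ℤ))).toTopRep (cycSubgroup 3 0 r))),
            (∀ g, ((ψ.1 g : geomTorsion W (((3 : ℕ) : ℤ) ^ j * ((3 : ℕ) : ℤ))) : geomPoints W) =
              TateModule.proj 3 (j + 1) (φ'.1 g)) →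
            Ψ (oneCocycleClass _ φ') = oneCocycleClass _ ψ) →
        ∀ (y : H1 (tateRep W 3) (cycSubgroup 3 0 r))
          (κ₀ : galoisCohomology (W.torsionGaloisModule (((3 : ℕ) : ℤ) ^ j * ((3 : ℕ) : ℤ))) 1) (s : ℤ_[3]),
          resSubgroup (W.torsionGaloisModule (((3 : ℕ) : ℤ) ^ j * ((3 : ℕ) : ℤ))).toTopRep
              (cycSubgroup 3 0 r) 1 κ₀ = Ψ y →
          galoisCohomology.localization (W.torsionGaloisModule (((3 : ℕ) : ℤ) ^ j * ((3 : ℕ) : ℤ)))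
              (Sum.inr v₃) 1 κ₀ ∈ propagatedSelmerStructure W 3 j (Sum.inr v₃) →
          (∃ l ∈ cycIntLattice 3 (cycLevel 3 0 r),
            (((3 : ℕ) : ℤ_[3]) ^ 0) • Λ 0 r y - ((s : ℚ_[3]) ⊗ₜ[ℚ] (1 : CyclotomicField (cycLevel 3 0 r) ℚ)) =
              (((3 : ℕ) : ℤ_[3]) ^ (j + 1)) • (l : ℚ_[3] ⊗[ℚ] CyclotomicField (cycLevel 3 0 r) ℚ)) →
          ((3 ^ e : ℕ) : ZMod (3 ^ (j + 1))) *
              Λfin j (galoisCohomology.localization (W.torsionGaloisModule (((3 : ℕ) : ℤ) ^ j * ((3 : ℕ) : ℤ)))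
                (Sum.inr v₃) 1 κ₀) = PadicInt.toZModPow (j + 1) s) ∧
      (∀ (j : ℕ) (y : (tateLocalRep W 3 (Sum.inr v₃)).cohomology 1) (s : ℤ_[3]),
        φ y = ((3 : ℕ) : ℚ_[3]) ^ e * s →
          Λfin j (tateLocalMap W 3 j (Sum.inr v₃) y) = PadicInt.toZModPow (j + 1) s) := by
  -- the exponent and the generator `g = 3^e` of `exp*_ω(H¹(ℚ₃, T₃E)) = (log_ω E(ℚ₃))^∨`
  set e : ℕ := padicValNat 3 ((W.baseChange ℚ_[3]).localTamagawaNumber ℤ_[3]) with hedef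
  set g : ℚ_[3] := ((3 : ℕ) : ℚ_[3]) ^ e with hgdef
  have hg0 : g ≠ 0 := pow_ne_zero _ (Nat.cast_ne_zero.mpr (by norm_num))
  have hgle : ‖g‖ ≤ 1 := by
    rw [hgdef, norm_pow]
    exact pow_le_one₀ (norm_nonneg _) (Padic.norm_p_lt_one (p := 3)).le
  -- the range of `φ` is `ℤ₃ · g`
  have hrange : ∀ a : ℚ_[3], (∃ y, φ y = a) ↔ ∃ c : ℤ_[3], (c : ℚ_[3]) * g = a := by
    intro a
    rw [hdual a, dual_range_padicLog_three_of_addv W hadd ht a, Submodule.mem_toAddSubgroup,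
      Submodule.mem_span_singleton]
    constructor
    · rintro ⟨c, rfl⟩
      exact ⟨c, by rw [Algebra.smul_def, PadicInt.algebraMap_apply]⟩
    · rintro ⟨c, rfl⟩
      exact ⟨c, by rw [Algebra.smul_def, PadicInt.algebraMap_apply]⟩
  have hint : ∀ y, ‖φ y‖ ≤ 1 := by
    intro y
    obtain ⟨c, hc⟩ := (hrange (φ y)).mp ⟨y, rfl⟩
    rw [← hc, norm_mul]
    exact mul_le_one₀ (PadicInt.norm_le_one c) (norm_nonneg _) hgle
  -- the rescaled functional `φ′ = g⁻¹ · φ`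
  set φ₁ : (tateLocalRep W 3 (Sum.inr v₃)).cohomology 1 →+ ℚ_[3] := (AddMonoidHom.mulLeft g⁻¹).comp φ
    with hφ₁def
  have hφ₁ : ∀ y, φ₁ y = g⁻¹ * φ y := fun y => rfl
  have hint₁ : ∀ y, ‖φ₁ y‖ ≤ 1 := by
    intro y
    obtain ⟨c, hc⟩ := (hrange (φ y)).mp ⟨y, rfl⟩
    rw [hφ₁, ← hc, ← mul_assoc, mul_comm g⁻¹, mul_assoc, inv_mul_cancel₀ hg0, mul_one]
    exact PadicInt.norm_le_one c
  have hsurj₁ : ∀ s : ℤ_[3], ∃ y, φ₁ y = s := by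
    intro s
    obtain ⟨y, hy⟩ := (hrange ((s : ℚ_[3]) * g)).mpr ⟨s, rfl⟩
    refine ⟨y, ?_⟩
    rw [hφ₁, hy, mul_comm (s : ℚ_[3]) g, ← mul_assoc, inv_mul_cancel₀ hg0, one_mul]
  have hker₁ : ∀ y, φ₁ y = 0 ↔ ∀ j : ℕ, tateLocalMap W 3 j (Sum.inr v₃) y ∈
      W.kummerSelmerStructure (((3 : ℕ) : ℤ) ^ j * ((3 : ℕ) : ℤ)) (Sum.inr v₃) := by
    intro y
    rw [← hker y, hφ₁, mul_eq_zero, or_iff_right (inv_ne_zero hg0)]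
  -- `Λfin_j` with the interface for `φ′`, and clause (i)
  choose Λfin hΛ using fun j => KimAtThreeFineKatoLemmaL.exists_functional_tateLocalMap_eq W 3 j (Sum.inr v₃)
    φ₁ hint₁ (KimAtThreeFineKatoLemmaL.tateLocalMap_surjective_three W ht v₃ hv₃ j)
  refine ⟨Λfin, e, rfl, fun j =>
    KimAtThreeFineKatoLemmaL.lambda_clauses_of_interface W 3 j (Sum.inr v₃) φ₁ hint₁ (hΛ j) hsurj₁ hker₁,
    ?_, ?_⟩
  · -- clause (ii₂): the tame-level scalar compatibility with the exponent `3^e`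
    intro j r Ψ hΨ y κ₀ s hres hloc hval
    obtain ⟨Λ₀, M, hΛ₀, hu, hM, hcompat⟩ := hsemi j r
    obtain ⟨h, hh⟩ := (mem_propagatedSelmerStructure_iff W 3 j (Sum.inr v₃) _).mp hloc
    obtain ⟨μ, hμ, he⟩ := hcompat Ψ hΨ y κ₀ h hres hh.symm
    set eh : ℤ_[3] := ⟨φ h, hint h⟩ with hehdef
    have hφe : φ h = (eh : ℚ_[3]) := rfl
    -- SAT₀: `φ(h) ≡ s (mod 3^{j+1})`
    have hsat : PadicInt.toZModPow (j + 1) eh = PadicInt.toZModPow (j + 1) s := by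
      rw [hφe] at he
      obtain ⟨l, hl, hs⟩ := cycIntLattice_premise_mem_span_ringOfIntegers 3 (cycLevel 3 0 r) hval
      rw [coe_tmul_one_eq_algebraMap] at he hs
      exact toZModPow_eq_of_sub_eq_smul_of_sub_eq_smul (Algebra.trace ℚ_[3] _)
        (norm_trace_mul_le_one_span_ringOfIntegers 3 (cycLevel 3 0 r) hΛ₀) hM hu hμ hl he hs
    -- the value of `Λfin_j` at `π h`: `φ′(h) mod 3^{j+1}`
    set s₁ : ℤ_[3] := ⟨φ₁ h, hint₁ h⟩ with hs₁def
    have hφ₁s : φ₁ h = (s₁ : ℚ_[3]) := rfl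
    have hes : eh = (3 : ℤ_[3]) ^ e * s₁ := by
      apply PadicInt.ext
      rw [PadicInt.coe_mul, PadicInt.coe_pow, ← hφe, ← hφ₁s, hφ₁, ← mul_assoc]
      have h3 : ((3 : ℤ_[3]) : ℚ_[3]) ^ e = g := by rw [hgdef]; norm_cast
      rw [h3, mul_inv_cancel₀ hg0, one_mul]
    rw [← hh, hΛ j h s₁ hφ₁s, ← hsat, hes, map_mul, map_pow]
    congr 1
    rw [Nat.cast_pow]
    congr 1
    rw [Nat.cast_ofNat, map_ofNat]
  · -- the interface in terms of `φ`
    intro j y s hy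
    refine hΛ j y s ?_
    rw [hφ₁, hy, ← mul_assoc, inv_mul_cancel₀ hg0, one_mul]

set_option maxHeartbeats 400000 in
/-- **The same two-exponent rider from the semi-local package in the `cycIntLattice` currency** (VERBATIM the
`hsemi` of kim3 gen 13's `KimAtThreeFineKatoRiderAssembly.exists_katoExpStarFiniteLevelAt_of_semiLocal`:
`Λ₀ ⊆ cycIntLattice 3 m = ℤ₃⟨1 ⊗ ζ_m^j⟩`), on EVERY additive `t = 0` row, ANY `c₃`: since
`cycIntLattice ≤ L_int′` (w2-acc4's `cycIntLattice_le_span_ringOfIntegers`) this is the previous theorem.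
[cite: Kim2022StructureSelmer, §3.3 (Lemma 3.11, Prop. 3.12), §3.4.1 and the proof of Thm. 3.13 (arXiv v3 pp. 26–27)]
[cite: BlochKato1990, §3 (Prop. 3.8, Ex. 3.11)] -/
theorem exists_fineKatoTwoExp_of_semiLocal (hadd : Addv W 3)
    (ht : Nat.card {Q : (W.baseChange ℚ_[3]).toAffine.Point // (3 : ℕ) • Q = 0} = 1)
    (v₃ : HeightOneSpectrum (𝓞 ℚ)) (hv₃ : ((3 : ℕ) : 𝓞 ℚ) ∈ v₃.asIdeal)
    (φ : (tateLocalRep W 3 (Sum.inr v₃)).cohomology 1 →+ ℚ_[3])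
    (hker : ∀ y, φ y = 0 ↔ ∀ j : ℕ, tateLocalMap W 3 j (Sum.inr v₃) y ∈
      W.kummerSelmerStructure (((3 : ℕ) : ℤ) ^ j * ((3 : ℕ) : ℤ)) (Sum.inr v₃))
    (hdual : ∀ a : ℚ_[3], (∃ y, φ y = a) ↔
      ∀ P : (W.baseChange ℚ_[3]).toAffine.Point, ‖a * padicLog (W.baseChange ℚ_[3]) P‖ ≤ 1)
    (Λ : ∀ (k' : ℕ) (r : Finset (HeightOneSpectrum (𝓞 ℚ))),
      H1 (tateRep W 3) (cycSubgroup 3 k' r) →ₗ[ℤ_[3]] ℚ_[3] ⊗[ℚ] CyclotomicField (cycLevel 3 k' r) ℚ)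
    (hsemi : ∀ (j : ℕ) (r : Finset (HeightOneSpectrum (𝓞 ℚ))),
      ∃ (Λ₀ : Set (ℚ_[3] ⊗[ℚ] CyclotomicField (cycLevel 3 0 r) ℚ))
        (M : Submodule ℤ_[3] (ℚ_[3] ⊗[ℚ] CyclotomicField (cycLevel 3 0 r) ℚ)),
        Λ₀ ⊆ cycIntLattice 3 (cycLevel 3 0 r) ∧
        (∃ ℓ ∈ Λ₀, ‖Algebra.trace ℚ_[3] (ℚ_[3] ⊗[ℚ] CyclotomicField (cycLevel 3 0 r) ℚ) ℓ‖ = 1) ∧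
        (∀ μ ∈ M, ∀ ℓ ∈ Λ₀,
          ‖Algebra.trace ℚ_[3] (ℚ_[3] ⊗[ℚ] CyclotomicField (cycLevel 3 0 r) ℚ) (μ * ℓ)‖ ≤ 1) ∧
        ∀ (Ψ : H1 (tateRep W 3) (cycSubgroup 3 0 r) →+
            continuousCohomology 1 (subgroupRep
              (W.torsionGaloisModule (((3 : ℕ) : ℤ) ^ j * ((3 : ℕ) : ℤ))).toTopRep (cycSubgroup 3 0 r))),
          (∀ (φ' : contOneCocycles (subgroupRep (tateRep W 3).toTopRep (cycSubgroup 3 0 r)))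
              (ψ : contOneCocycles (subgroupRep
                (W.torsionGaloisModule (((3 : ℕ) : ℤ) ^ j * ((3 : ℕ) : ℤ))).toTopRep (cycSubgroup 3 0 r))),
              (∀ g, ((ψ.1 g : geomTorsion W (((3 : ℕ) : ℤ) ^ j * ((3 : ℕ) : ℤ))) : geomPoints W) =
                TateModule.proj 3 (j + 1) (φ'.1 g)) →
              Ψ (oneCocycleClass _ φ') = oneCocycleClass _ ψ) →
          ∀ (y : H1 (tateRep W 3) (cycSubgroup 3 0 r))
            (κ₀ : galoisCohomology (W.torsionGaloisModule (((3 : ℕ) : ℤ) ^ j * ((3 : ℕ) : ℤ))) 1)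
            (h : (tateLocalRep W 3 (Sum.inr v₃)).cohomology 1),
            resSubgroup (W.torsionGaloisModule (((3 : ℕ) : ℤ) ^ j * ((3 : ℕ) : ℤ))).toTopRep
                (cycSubgroup 3 0 r) 1 κ₀ = Ψ y →
            galoisCohomology.localization (W.torsionGaloisModule (((3 : ℕ) : ℤ) ^ j * ((3 : ℕ) : ℤ)))
                (Sum.inr v₃) 1 κ₀ = tateLocalMap W 3 j (Sum.inr v₃) h →
            ∃ μ ∈ M, (φ h ⊗ₜ[ℚ] (1 : CyclotomicField (cycLevel 3 0 r) ℚ)) -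
                (((3 : ℕ) : ℤ_[3]) ^ (0 : ℕ)) • Λ 0 r y = (((3 : ℕ) : ℤ_[3]) ^ (j + 1)) • (μ : _)) :
    ∃ (Λfin : ∀ j : ℕ, galoisCohomology
        ((W.torsionGaloisModule (((3 : ℕ) : ℤ) ^ j * ((3 : ℕ) : ℤ))).toLocal (Sum.inr v₃)) 1 →+
          ZMod (3 ^ (j + 1))) (e : ℕ),
      e = padicValNat 3 ((W.baseChange ℚ_[3]).localTamagawaNumber ℤ_[3]) ∧
      (∀ j : ℕ, (∀ c : ZMod (3 ^ (j + 1)), ∃ x ∈ propagatedSelmerStructure W 3 j (Sum.inr v₃), Λfin j x = c) ∧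
        (∀ x ∈ propagatedSelmerStructure W 3 j (Sum.inr v₃),
          Λfin j x = 0 ↔ x ∈ W.kummerSelmerStructure (((3 : ℕ) : ℤ) ^ j * ((3 : ℕ) : ℤ)) (Sum.inr v₃))) ∧
      (∀ j : ℕ, ∀ (r : Finset (HeightOneSpectrum (𝓞 ℚ)))
        (Ψ : H1 (tateRep W 3) (cycSubgroup 3 0 r) →+
          continuousCohomology 1 (subgroupRep
            (W.torsionGaloisModule (((3 : ℕ) : ℤ) ^ j * ((3 : ℕ) : ℤ))).toTopRep (cycSubgroup 3 0 r))),
        (∀ (φ' : contOneCocycles (subgroupRep (tateRep W 3).toTopRep (cycSubgroup 3 0 r)))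
            (ψ : contOneCocycles (subgroupRep
              (W.torsionGaloisModule (((3 : ℕ) : ℤ) ^ j * ((3 : ℕ) : ℤ))).toTopRep (cycSubgroup 3 0 r))),
            (∀ g, ((ψ.1 g : geomTorsion W (((3 : ℕ) : ℤ) ^ j * ((3 : ℕ) : ℤ))) : geomPoints W) =
              TateModule.proj 3 (j + 1) (φ'.1 g)) →
            Ψ (oneCocycleClass _ φ') = oneCocycleClass _ ψ) →
        ∀ (y : H1 (tateRep W 3) (cycSubgroup 3 0 r))
          (κ₀ : galoisCohomology (W.torsionGaloisModule (((3 : ℕ) : ℤ) ^ j * ((3 : ℕ) : ℤ))) 1) (s : ℤ_[3]),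
          resSubgroup (W.torsionGaloisModule (((3 : ℕ) : ℤ) ^ j * ((3 : ℕ) : ℤ))).toTopRep
              (cycSubgroup 3 0 r) 1 κ₀ = Ψ y →
          galoisCohomology.localization (W.torsionGaloisModule (((3 : ℕ) : ℤ) ^ j * ((3 : ℕ) : ℤ)))
              (Sum.inr v₃) 1 κ₀ ∈ propagatedSelmerStructure W 3 j (Sum.inr v₃) →
          (∃ l ∈ cycIntLattice 3 (cycLevel 3 0 r),
            (((3 : ℕ) : ℤ_[3]) ^ 0) • Λ 0 r y - ((s : ℚ_[3]) ⊗ₜ[ℚ] (1 : CyclotomicField (cycLevel 3 0 r) ℚ)) =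
              (((3 : ℕ) : ℤ_[3]) ^ (j + 1)) • (l : ℚ_[3] ⊗[ℚ] CyclotomicField (cycLevel 3 0 r) ℚ)) →
          ((3 ^ e : ℕ) : ZMod (3 ^ (j + 1))) *
              Λfin j (galoisCohomology.localization (W.torsionGaloisModule (((3 : ℕ) : ℤ) ^ j * ((3 : ℕ) : ℤ)))
                (Sum.inr v₃) 1 κ₀) = PadicInt.toZModPow (j + 1) s) ∧
      (∀ (j : ℕ) (y : (tateLocalRep W 3 (Sum.inr v₃)).cohomology 1) (s : ℤ_[3]),
        φ y = ((3 : ℕ) : ℚ_[3]) ^ e * s →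
          Λfin j (tateLocalMap W 3 j (Sum.inr v₃) y) = PadicInt.toZModPow (j + 1) s) := by
  refine exists_fineKatoTwoExp_of_semiLocalInt W hadd ht v₃ hv₃ φ hker hdual Λ fun j r => ?_
  obtain ⟨Λ₀, M, hΛ₀, hu, hM, hcompat⟩ := hsemi j r
  exact ⟨Λ₀, M, fun x hx => KimAtThreeFineKatoSemiLocalLattice.cycIntLattice_le_span_ringOfIntegers 3
    (cycLevel 3 0 r) (hΛ₀ hx), hu, hM, hcompat⟩

end Summit.BirchSwinnertonDyer.BirchSwinnertonDyer.Theorems.KimAtThreeFineKatoTwoExpRiderAssembly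

end
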